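import Summits.ResolutionOfSingularities.ResolutionOfSingularities.Theorems.FrobeniusLadderFInjectiveMacaulayficationZxyGradedData
import Summits.ResolutionOfSingularities.ResolutionOfSingularities.Theorems.FrobeniusLadderFInjectiveMacaulayficationWeightedConeCore
import Summits.ResolutionOfSingularities.ResolutionOfSingularities.Theorems.FrobeniusLadderFInjectiveMacaulayficationGradedConeFiModel
import Literature.AlgebraicGeometry.Resolution.ComponentGluing
import Mathlib.AlgebraicGeometry.Morphisms.Proper
import Mathlib.RingTheory.Ideal.Quotient.Operations
import Mathlib.Algebra.CharP.Lemmas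
import HarnessLib

/-!
# `z² + x²y² + x⁵ + y⁵` in characteristic `2`: ONE `(2,2,5)`-weighted blow-up modulo the graded engine (via the normal form)
# (crux `FInjectiveMacaulayfication`, line `graded-engine` §16, calibration G6g = idea-1 matrix row 3 «zxy»)

Support file for crux stmt-ResolutionOfSingularities-15315 (`FrobeniusLadder.FInjectiveMacaulayfication`), chain w45a,
seat res-L1-w45a-stub-3. [OURS · L1 W4.5a; idea-1 r2 TEST MATRIX row 3] — NOT a statement of the manuscript; AI-written, weaker
than expert review.

* `model_of_ringEquiv` — TRANSPORT of the crux's model conclusion along a ring isomorphism of the base: a proper birational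
  model with good stalks over `Spec S` gives one over `Spec R ≅ Spec S` (compose with the induced isomorphism of spectra;
  `ComponentGluing.IsBirational.comp`, an isomorphism being birational with `U = ⊤`);
* `zxyNF_gradedFiModel_of_gradedEngine` — the registered statement of G5 `stub_gradedConeFiModel` (verbatim, as a hypothesis)
  implies: for every prime `p ≠ 5` and field `k` of characteristic `p`, `Spec k[X]/(X₂² + X₀⁵ + X₁⁵)` has a proper birational model
  with Cohen–Macaulay F-injective domain stalks — the `(2,2,5)`-weighted blow-up `affineBlowup I₁₀` (`c = (5,5,2)`, `D = 10`; data
  `ZxyGradedData`);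
* `exists_shear`, `span_map_shear` — the shear `σ : X₂ ↦ X₂ + X₀X₁` of `k[X₀,X₁,X₂]` (a ring automorphism over any field) carries
  `f = X₂² + X₀²X₁² + X₀⁵ + X₁⁵` to the normal form in characteristic `2` (`σ f = X₂² + X₀⁵ + X₁⁵ + 2·(X₀X₁X₂ + X₀²X₁²)`);
* `zxy_gradedFiModel_char2_of_gradedEngine` — hence, modulo G5: over every field of characteristic `2`, tri-1's second frontier
  specimen `Spec k[X]/(X₂² + X₀²X₁² + X₀⁵ + X₁⁵)` (which NO tower of point blow-ups normalises, SURVEY j023222) has a proper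
  birational model with Cohen–Macaulay F-injective domain stalks — ONE weighted blow-up in the sheared coordinates (idea-1's
  prediction, matrix row 3). Unconditional the moment G5 lands.

All proofs are glue on Mathlib and landed files; no definitions, no named facts. [folklore]
-/

-- single-problem summit: the doubled namespace component is forced
set_option linter.dupNamespace false

noncomputable section

open CategoryTheory AlgebraicGeometry

namespace Summit.ResolutionOfSingularities.ResolutionOfSingularities.Theorems.FInjectiveMacaulayfication.ZxyGradedFiModel

open MvPolynomial
open Summit.ResolutionOfSingularities.ResolutionOfSingularities.Theorems.FInjectiveMacaulayfication

/-! ## Transport of the model along a ring isomorphism of the base -/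

/-- **Transport of the crux's model along `R ≃+* S`**: a proper birational model of `Spec S` with Cohen–Macaulay F-injective
domain stalks yields one of `Spec R` (compose with `Spec S ≅ Spec R`). [folklore] -/
theorem model_of_ringEquiv (p : ℕ) {R S : Type} [CommRing R] [CommRing S] (e : R ≃+* S)
    (h : ∃ (X' : Scheme.{0}) (π : X' ⟶ Spec (.of S)), IsProper π ∧
      Literature.AlgebraicGeometry.Resolution.IsBirational π ∧
      ∀ y : X', IsDomain (X'.presheaf.stalk y) ∧ ∀ d : ℕ, ringKrullDim (X'.presheaf.stalk y) = d →
        ∀ s : Fin d → X'.presheaf.stalk y, (Ideal.span (Set.range s)).radical.IsMaximal →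
          RingTheory.Sequence.IsWeaklyRegular (X'.presheaf.stalk y) (List.ofFn s) ∧
          ∀ z : X'.presheaf.stalk y, (∃ e : ℕ, z ^ p ^ e ∈
              Ideal.span ((fun w : X'.presheaf.stalk y => w ^ p ^ e) ''
                (Ideal.span (Set.range s) : Set (X'.presheaf.stalk y)))) →
            z ∈ Ideal.span (Set.range s)) :
    ∃ (X' : Scheme.{0}) (π : X' ⟶ Spec (.of R)), IsProper π ∧
      Literature.AlgebraicGeometry.Resolution.IsBirational π ∧
      ∀ y : X', IsDomain (X'.presheaf.stalk y) ∧ ∀ d : ℕ, ringKrullDim (X'.presheaf.stalk y) = d →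
        ∀ s : Fin d → X'.presheaf.stalk y, (Ideal.span (Set.range s)).radical.IsMaximal →
          RingTheory.Sequence.IsWeaklyRegular (X'.presheaf.stalk y) (List.ofFn s) ∧
          ∀ z : X'.presheaf.stalk y, (∃ e : ℕ, z ^ p ^ e ∈
              Ideal.span ((fun w : X'.presheaf.stalk y => w ^ p ^ e) ''
                (Ideal.span (Set.range s) : Set (X'.presheaf.stalk y)))) →
            z ∈ Ideal.span (Set.range s) := by
  obtain ⟨X', π, hP, hB, hS⟩ := h
  have hι : Literature.AlgebraicGeometry.Resolution.IsBirational (Spec.map e.toCommRingCatIso.hom) :=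
    ⟨⊤, by simp, by simp, inferInstance⟩
  exact ⟨X', π ≫ Spec.map e.toCommRingCatIso.hom, inferInstance,
    Literature.AlgebraicGeometry.Resolution.ComponentGluing.IsBirational.comp hB hι, hS⟩

/-! ## The normal form at every `p ≠ 5`, modulo G5 -/

/-- **G6g modulo G5, normal form**: assuming the registered statement of G5 `stub_gradedConeFiModel` (hypothesis `hG5`, verbatim),
for every prime `p ≠ 5` and field `k` of characteristic `p`, `Spec k[X₀,X₁,X₂]/(X₂² + X₀⁵ + X₁⁵)` has a proper birational model —
the `(2,2,5)`-weighted blow-up of the origin, `affineBlowup I₁₀`, `c = (5,5,2)`, `D = 10` — all of whose stalks are domains in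
which every system of parameters is weakly regular and generates a Frobenius closed ideal. [folklore] -/
theorem zxyNF_gradedFiModel_of_gradedEngine
    (hG5 : ∀ (p : ℕ) [Fact p.Prime] (k : Type) [Field k] [CharP k p] (n : ℕ) (w : Fin n → ℕ) (N D : ℕ)
      (c : Fin n → ℕ), 0 < N → (∀ v : Fin n, 0 < w v ∧ c v * w v = N) →
      (∀ (K : ℕ) (b : Fin n →₀ ℕ), K * N ≤ Finsupp.weight w b → (MvPolynomial.monomial b (1 : k) : MvPolynomial (Fin n) k) ∈
        (Ideal.span {m : MvPolynomial (Fin n) k | ∃ b : Fin n →₀ ℕ, N ≤ Finsupp.weight w b ∧ m = MvPolynomial.monomial b 1}) ^ K) →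
      ∀ (f : MvPolynomial (Fin n) k), MvPolynomial.IsWeightedHomogeneous w f D → (Ideal.span {f}).IsPrime →
      (∀ v : Fin n, Ideal.Quotient.mk (Ideal.span {f}) (MvPolynomial.X v) ≠ 0) →
      (∀ (Q : Ideal (MvPolynomial (Fin n) k ⧸ Ideal.span {f})) [Q.IsMaximal],
        (∃ j : Fin n, Ideal.Quotient.mk (Ideal.span {f}) (MvPolynomial.X j) ∉ Q) →
        ∀ d : ℕ, ringKrullDim (Localization.AtPrime Q) = d → ∀ s : Fin d → Localization.AtPrime Q,
          (Ideal.span (Set.range s)).radical.IsMaximal →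
            RingTheory.Sequence.IsWeaklyRegular (Localization.AtPrime Q) (List.ofFn s) ∧
            ∀ y : Localization.AtPrime Q, (∃ e : ℕ, y ^ p ^ e ∈ Ideal.span
              ((fun z : Localization.AtPrime Q => z ^ p ^ e) ''
                (Ideal.span (Set.range s) : Set (Localization.AtPrime Q)))) → y ∈ Ideal.span (Set.range s)) →
      ∃ (X' : Scheme.{0}) (π : X' ⟶ Spec (.of (MvPolynomial (Fin n) k ⧸ Ideal.span {f}))), IsProper π ∧
        Literature.AlgebraicGeometry.Resolution.IsBirational π ∧
        ∀ y : X', IsDomain (X'.presheaf.stalk y) ∧ ∀ d : ℕ, ringKrullDim (X'.presheaf.stalk y) = d →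
          ∀ s : Fin d → X'.presheaf.stalk y, (Ideal.span (Set.range s)).radical.IsMaximal →
            RingTheory.Sequence.IsWeaklyRegular (X'.presheaf.stalk y) (List.ofFn s) ∧
            ∀ z : X'.presheaf.stalk y, (∃ e : ℕ, z ^ p ^ e ∈
                Ideal.span ((fun w : X'.presheaf.stalk y => w ^ p ^ e) ''
                  (Ideal.span (Set.range s) : Set (X'.presheaf.stalk y)))) →
              z ∈ Ideal.span (Set.range s)) :
    ∀ (p : ℕ) [Fact p.Prime], p ≠ 5 → ∀ (k : Type) [Field k] [CharP k p] (f : MvPolynomial (Fin 3) k),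
      f = MvPolynomial.X 2 ^ 2 + MvPolynomial.X 0 ^ 5 + MvPolynomial.X 1 ^ 5 →
      ∃ (X' : Scheme.{0}) (π : X' ⟶ Spec (.of (MvPolynomial (Fin 3) k ⧸ Ideal.span {f}))), IsProper π ∧
        Literature.AlgebraicGeometry.Resolution.IsBirational π ∧
        ∀ y : X', IsDomain (X'.presheaf.stalk y) ∧ ∀ d : ℕ, ringKrullDim (X'.presheaf.stalk y) = d →
          ∀ s : Fin d → X'.presheaf.stalk y, (Ideal.span (Set.range s)).radical.IsMaximal →
            RingTheory.Sequence.IsWeaklyRegular (X'.presheaf.stalk y) (List.ofFn s) ∧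
            ∀ z : X'.presheaf.stalk y, (∃ e : ℕ, z ^ p ^ e ∈
                Ideal.span ((fun w : X'.presheaf.stalk y => w ^ p ^ e) ''
                  (Ideal.span (Set.range s) : Set (X'.presheaf.stalk y)))) →
              z ∈ Ideal.span (Set.range s) := by
  intro p _ hp5 k _ _ f hf
  refine hG5 p k 3 ![2, 2, 5] 10 10 ![5, 5, 2] (by norm_num) (by decide)
    (ZxyGradedData.zxyNFVeroneseSplitting k) f ?_ (ZxyGradedData.span_zxyNF_isPrime k f hf)
    (ZxyGradedData.zxyNF_X_ne_zero k f hf) (ZxyGradedData.zxyNF_offOrigin_clause p hp5 k f hf)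
  rw [hf]
  exact ZxyGradedData.zxyNF_isWeightedHomogeneous k

/-! ## The shear `X₂ ↦ X₂ + X₀X₁` and the original specimen in characteristic `2` -/

/-- **The shear** `σ : X₀ ↦ X₀, X₁ ↦ X₁, X₂ ↦ X₂ + X₀X₁` as a ring automorphism of `k[X₀,X₁,X₂]` (inverse `X₂ ↦ X₂ − X₀X₁`).
[folklore] -/
theorem exists_shear (k : Type) [Field k] :
    ∃ σ : MvPolynomial (Fin 3) k ≃+* MvPolynomial (Fin 3) k,
      σ (X 0) = X 0 ∧ σ (X 1) = X 1 ∧ σ (X 2) = X 2 + X 0 * X 1 := by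
  let s : MvPolynomial (Fin 3) k →ₐ[k] MvPolynomial (Fin 3) k := aeval ![X 0, X 1, X 2 + X 0 * X 1]
  let t : MvPolynomial (Fin 3) k →ₐ[k] MvPolynomial (Fin 3) k := aeval ![X 0, X 1, X 2 - X 0 * X 1]
  have hst : s.comp t = AlgHom.id k _ := by
    refine MvPolynomial.algHom_ext fun j => ?_
    fin_cases j <;> simp [s, t]
  have hts : t.comp s = AlgHom.id k _ := by
    refine MvPolynomial.algHom_ext fun j => ?_
    fin_cases j <;> simp [s, t]
  refine ⟨(AlgEquiv.ofAlgHom s t hst hts).toRingEquiv, ?_, ?_, ?_⟩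
  · show s (X 0) = X 0
    simp [s]
  · show s (X 1) = X 1
    simp [s]
  · show s (X 2) = X 2 + X 0 * X 1
    simp [s]

/-- **The shear carries `f = X₂² + X₀²X₁² + X₀⁵ + X₁⁵` onto the normal form in characteristic `2`**: `(σ f) = (X₂² + X₀⁵ + X₁⁵)`
as ideals (indeed `σ f = X₂² + X₀⁵ + X₁⁵` since `2 = 0`). [folklore] -/
theorem span_map_shear (k : Type) [Field k] [CharP k 2] (σ : MvPolynomial (Fin 3) k ≃+* MvPolynomial (Fin 3) k)
    (h0 : σ (X 0) = X 0) (h1 : σ (X 1) = X 1) (h2 : σ (X 2) = X 2 + X 0 * X 1) (f : MvPolynomial (Fin 3) k)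
    (hf : f = X 2 ^ 2 + X 0 ^ 2 * X 1 ^ 2 + X 0 ^ 5 + X 1 ^ 5) :
    (Ideal.span {f}).map σ = Ideal.span {(X 2 ^ 2 + X 0 ^ 5 + X 1 ^ 5 : MvPolynomial (Fin 3) k)} := by
  have htwo : (2 : MvPolynomial (Fin 3) k) = 0 := by
    have h2 : (2 : k) = 0 := by
      have h := CharP.cast_eq_zero k 2
      simpa using h
    rw [← map_ofNat (C : k →+* MvPolynomial (Fin 3) k) 2, h2, map_zero]
  have hσf : σ f = X 2 ^ 2 + X 0 ^ 5 + X 1 ^ 5 := by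
    rw [hf]
    simp only [map_add, map_mul, map_pow, h0, h1, h2]
    have e : ((X 2 + X 0 * X 1) ^ 2 + X 0 ^ 2 * X 1 ^ 2 + X 0 ^ 5 + X 1 ^ 5 : MvPolynomial (Fin 3) k) =
        X 2 ^ 2 + X 0 ^ 5 + X 1 ^ 5 + 2 * (X 0 * X 1 * X 2 + X 0 ^ 2 * X 1 ^ 2) := by ring
    rw [e, htwo, zero_mul, add_zero]
  rw [Ideal.map_span, Set.image_singleton, hσf]

/-- **G6g modulo G5 — tri-1's specimen `z² + x²y² + x⁵ + y⁵` IN CHARACTERISTIC `2` is F-injectively Macaulayfied by ONE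
weighted blow-up** (idea-1 matrix row 3; no tower of point blow-ups normalises it): assuming the registered statement of G5
`stub_gradedConeFiModel`, for every field `k` of characteristic `2`, `Spec k[X₀,X₁,X₂]/(X₂² + X₀²X₁² + X₀⁵ + X₁⁵)` has a proper
birational model all of whose stalks are domains in which every system of parameters is weakly regular and generates a Frobenius
closed ideal — the `(2,2,5)`-weighted blow-up of the origin in the sheared coordinates `z′ = z + xy`
(`zxyNF_gradedFiModel_of_gradedEngine` transported along `k[X]/(f) ≅ k[X]/(σ f)`, `model_of_ringEquiv`). [folklore] -/
theorem zxy_gradedFiModel_char2_of_gradedEngine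
    (hG5 : ∀ (p : ℕ) [Fact p.Prime] (k : Type) [Field k] [CharP k p] (n : ℕ) (w : Fin n → ℕ) (N D : ℕ)
      (c : Fin n → ℕ), 0 < N → (∀ v : Fin n, 0 < w v ∧ c v * w v = N) →
      (∀ (K : ℕ) (b : Fin n →₀ ℕ), K * N ≤ Finsupp.weight w b → (MvPolynomial.monomial b (1 : k) : MvPolynomial (Fin n) k) ∈
        (Ideal.span {m : MvPolynomial (Fin n) k | ∃ b : Fin n →₀ ℕ, N ≤ Finsupp.weight w b ∧ m = MvPolynomial.monomial b 1}) ^ K) →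
      ∀ (f : MvPolynomial (Fin n) k), MvPolynomial.IsWeightedHomogeneous w f D → (Ideal.span {f}).IsPrime →
      (∀ v : Fin n, Ideal.Quotient.mk (Ideal.span {f}) (MvPolynomial.X v) ≠ 0) →
      (∀ (Q : Ideal (MvPolynomial (Fin n) k ⧸ Ideal.span {f})) [Q.IsMaximal],
        (∃ j : Fin n, Ideal.Quotient.mk (Ideal.span {f}) (MvPolynomial.X j) ∉ Q) →
        ∀ d : ℕ, ringKrullDim (Localization.AtPrime Q) = d → ∀ s : Fin d → Localization.AtPrime Q,
          (Ideal.span (Set.range s)).radical.IsMaximal →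
            RingTheory.Sequence.IsWeaklyRegular (Localization.AtPrime Q) (List.ofFn s) ∧
            ∀ y : Localization.AtPrime Q, (∃ e : ℕ, y ^ p ^ e ∈ Ideal.span
              ((fun z : Localization.AtPrime Q => z ^ p ^ e) ''
                (Ideal.span (Set.range s) : Set (Localization.AtPrime Q)))) → y ∈ Ideal.span (Set.range s)) →
      ∃ (X' : Scheme.{0}) (π : X' ⟶ Spec (.of (MvPolynomial (Fin n) k ⧸ Ideal.span {f}))), IsProper π ∧
        Literature.AlgebraicGeometry.Resolution.IsBirational π ∧
        ∀ y : X', IsDomain (X'.presheaf.stalk y) ∧ ∀ d : ℕ, ringKrullDim (X'.presheaf.stalk y) = d →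
          ∀ s : Fin d → X'.presheaf.stalk y, (Ideal.span (Set.range s)).radical.IsMaximal →
            RingTheory.Sequence.IsWeaklyRegular (X'.presheaf.stalk y) (List.ofFn s) ∧
            ∀ z : X'.presheaf.stalk y, (∃ e : ℕ, z ^ p ^ e ∈
                Ideal.span ((fun w : X'.presheaf.stalk y => w ^ p ^ e) ''
                  (Ideal.span (Set.range s) : Set (X'.presheaf.stalk y)))) →
              z ∈ Ideal.span (Set.range s)) :
    ∀ (k : Type) [Field k] [CharP k 2] (f : MvPolynomial (Fin 3) k),
      f = MvPolynomial.X 2 ^ 2 + MvPolynomial.X 0 ^ 2 * MvPolynomial.X 1 ^ 2 + MvPolynomial.X 0 ^ 5 + MvPolynomial.X 1 ^ 5 →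
      ∃ (X' : Scheme.{0}) (π : X' ⟶ Spec (.of (MvPolynomial (Fin 3) k ⧸ Ideal.span {f}))), IsProper π ∧
        Literature.AlgebraicGeometry.Resolution.IsBirational π ∧
        ∀ y : X', IsDomain (X'.presheaf.stalk y) ∧ ∀ d : ℕ, ringKrullDim (X'.presheaf.stalk y) = d →
          ∀ s : Fin d → X'.presheaf.stalk y, (Ideal.span (Set.range s)).radical.IsMaximal →
            RingTheory.Sequence.IsWeaklyRegular (X'.presheaf.stalk y) (List.ofFn s) ∧
            ∀ z : X'.presheaf.stalk y, (∃ e : ℕ, z ^ 2 ^ e ∈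
                Ideal.span ((fun w : X'.presheaf.stalk y => w ^ 2 ^ e) ''
                  (Ideal.span (Set.range s) : Set (X'.presheaf.stalk y)))) →
              z ∈ Ideal.span (Set.range s) := by
  intro k _ _ f hf
  haveI : Fact (Nat.Prime 2) := ⟨Nat.prime_two⟩
  obtain ⟨σ, h0, h1, h2⟩ := exists_shear k
  -- `k[X]/(f) ≅ k[X]/(σ f) = k[X]/(normal form)`
  have e : MvPolynomial (Fin 3) k ⧸ Ideal.span {f} ≃+*
      MvPolynomial (Fin 3) k ⧸ Ideal.span {(X 2 ^ 2 + X 0 ^ 5 + X 1 ^ 5 : MvPolynomial (Fin 3) k)} :=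
    Ideal.quotientEquiv _ _ σ (span_map_shear k σ h0 h1 h2 f hf).symm
  exact model_of_ringEquiv 2 e (zxyNF_gradedFiModel_of_gradedEngine hG5 2 (by decide) k _ rfl)

/-- **`z² + x⁵ + y⁵` IN ONE `(2,2,5)`-WEIGHTED BLOW-UP AT EVERY `p ≠ 5` — UNCONDITIONAL** (the graded engine G5
`GradedConeFiModel.stub_gradedConeFiModel` has LANDED, p488729). [folklore] -/
theorem zxyNF_gradedFiModel : ∀ (p : ℕ) [Fact p.Prime], p ≠ 5 → ∀ (k : Type) [Field k] [CharP k p] (f : MvPolynomial (Fin 3) k),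
      f = MvPolynomial.X 2 ^ 2 + MvPolynomial.X 0 ^ 5 + MvPolynomial.X 1 ^ 5 →
      ∃ (X' : Scheme.{0}) (π : X' ⟶ Spec (.of (MvPolynomial (Fin 3) k ⧸ Ideal.span {f}))), IsProper π ∧
        Literature.AlgebraicGeometry.Resolution.IsBirational π ∧
        ∀ y : X', IsDomain (X'.presheaf.stalk y) ∧ ∀ d : ℕ, ringKrullDim (X'.presheaf.stalk y) = d →
          ∀ s : Fin d → X'.presheaf.stalk y, (Ideal.span (Set.range s)).radical.IsMaximal →
            RingTheory.Sequence.IsWeaklyRegular (X'.presheaf.stalk y) (List.ofFn s) ∧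
            ∀ z : X'.presheaf.stalk y, (∃ e : ℕ, z ^ p ^ e ∈
                Ideal.span ((fun w : X'.presheaf.stalk y => w ^ p ^ e) ''
                  (Ideal.span (Set.range s) : Set (X'.presheaf.stalk y)))) →
              z ∈ Ideal.span (Set.range s) :=
  zxyNF_gradedFiModel_of_gradedEngine GradedConeFiModel.stub_gradedConeFiModel

/-- **tri-1's specimen `z² + x²y² + x⁵ + y⁵` IN CHARACTERISTIC `2` IS F-INJECTIVELY MACAULAYFIED BY ONE WEIGHTED BLOW-UP —
UNCONDITIONAL** (G6g = idea-1 matrix row 3; no tower of point blow-ups normalises this point; the graded engine G5 has LANDED,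
p488729): the `(2,2,5)`-weighted blow-up in the sheared coordinates `z′ = z + xy`. [folklore] -/
theorem zxy_gradedFiModel_char2 : ∀ (k : Type) [Field k] [CharP k 2] (f : MvPolynomial (Fin 3) k),
      f = MvPolynomial.X 2 ^ 2 + MvPolynomial.X 0 ^ 2 * MvPolynomial.X 1 ^ 2 + MvPolynomial.X 0 ^ 5 + MvPolynomial.X 1 ^ 5 →
      ∃ (X' : Scheme.{0}) (π : X' ⟶ Spec (.of (MvPolynomial (Fin 3) k ⧸ Ideal.span {f}))), IsProper π ∧
        Literature.AlgebraicGeometry.Resolution.IsBirational π ∧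
        ∀ y : X', IsDomain (X'.presheaf.stalk y) ∧ ∀ d : ℕ, ringKrullDim (X'.presheaf.stalk y) = d →
          ∀ s : Fin d → X'.presheaf.stalk y, (Ideal.span (Set.range s)).radical.IsMaximal →
            RingTheory.Sequence.IsWeaklyRegular (X'.presheaf.stalk y) (List.ofFn s) ∧
            ∀ z : X'.presheaf.stalk y, (∃ e : ℕ, z ^ 2 ^ e ∈
                Ideal.span ((fun w : X'.presheaf.stalk y => w ^ 2 ^ e) ''
                  (Ideal.span (Set.range s) : Set (X'.presheaf.stalk y)))) →
              z ∈ Ideal.span (Set.range s) :=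
  zxy_gradedFiModel_char2_of_gradedEngine GradedConeFiModel.stub_gradedConeFiModel

end Summit.ResolutionOfSingularities.ResolutionOfSingularities.Theorems.FInjectiveMacaulayfication.ZxyGradedFiModel

end
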